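import Summits.QuantumFields.YangMills.Theorems.UnitScaleTiltProp7LatticeWeitzenbockZd
import HarnessLib

/-!
# Route `UnitScaleTilt`, crux K1 «MinimiserStabilityRegPr» (stmt-QuantumFields-19200) — route-R E′ (A′), (N06) coercivity row `hCo`, LANE II «DIVERGENCE RECOVERY»
# (★★OWNER g29 WORD 2026-08-29T05:46Z «px4: GO-A — (B0) + (B1)-FLAT»; LOCATE #60 brick (B1), part 2∕2): **THE LATTICE FRIEDRICHS INEQUALITY ON A BOX** —
# `Σ‖g‖² ≤ M²·(½·CURL_inside + DIV_box)` for a one-form living on the edges of an `M`-box of `ℤᵈ`, graph divergence (zero-flux boundary condition built in), curl over the plaquettes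
# INSIDE the box only, NO mean ∕ harmonic term (`H¹(box) = 0`)

Cell `ym3-torus`, width seat `ym3-torus-px4` (gen 7).  THEOREMS ONLY (0 `def`, 0 `sorry`); `--supports stmt-QuantumFields-19200 --as helper`, count-neutral; consumer-independent
(lane-agnostic: serves LANE II S4(d) of LOCATE #60 — the transverse remainder of a local Coulomb potential — and any local-energy argument, e.g. the (I3′) filling certificates).  YM₃ on T³
is a ladder rung (R3), not d = 4, not infinite volume, not the Clay problem; nothing here claims [Balaban1985BackgroundPropagators] Thm 3.3 ∕ 3.11, `hCo`, `hN06`, E′, EX, H, the crux or the gap.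

LETTERS: as in part 1∕2 (lit ✓`B4Eq19LatticeOperators`: `Zd d`, `unitVec`, `box`, `fdiff`, `dvg`); the one-form `g` «lives on the edges of `Q_R(z)`» when `g y μ = 0` unless both `y` and `y + e_μ`
lie in `Q_R(z)`; then `dvg g` IS the graph divergence of the box (missing outside edges contribute `0`) and a plaquette `(y; μ, ν)` is inside the box iff `y, y + e_μ + e_ν ∈ Q_R(z)`.

WHAT IS PROVED (ns `…Theorems.Prop7LatticeBoxFriedrichs`):
* §1 box lemmas: `add_unitVec_apply`, `mem_box_and_of_add_unitVec_mem` (two adjacent corners in the box ⟹ the unit square is), ★`fdiff_mul_fdiff_eq_zero_of_not_inside` (a plaquette NOT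
  inside the box carries at most one box edge), `curl_sq_eq_of_not_inside`, `curl_sq_le_inside_add` (termwise: every squared curl ≤ its inside part + the two transverse-gradient squares).
* §2 `support_of_edges`, `dvg_eq_zero_of_not_mem`, `fdiff_sq_eq_zero_of_not_mem`, `sum_le_sum_of_support`; ★★`sum_longitudinal_sq_le` (STEP 1: `Σ_μ Σ (∂_μ g_μ)² ≤ ½·CURL_inside + DIV_box`,
  from part 1∕2's Weitzenböck identity minus the transverse squares); `sq_le_line_sum`, `sum_sq_le_longitudinal` (STEP 2: telescoping along each `μ`-line, `2R + 1` steps leave the box,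
  Cauchy–Schwarz); ★★★`sum_sq_le_box_friedrichs` — for `g` living on the edges of `Q_R(z)` (`0 ≤ R`, `M = 2R + 1`):
  `Σ_{y∈Q_R} Σ_μ (g y μ)² ≤ (2R+1)²·(½·Σ_{y∈Q_R} Σ_μ Σ_ν [y + e_μ + e_ν ∈ Q_R]·(∂_μ g_ν − ∂_ν g_μ)(y)² + Σ_{y∈Q_R} (∂*g)(y)²)`; and the KILL TEST (F1) of LOCATE #60 as an in-file `example`
  (`ℤ³`).  Constant `M²` is crude: sharp is `1∕(2(1 − cos(π∕M))) ≤ M²∕8` (kit j326138: `λ_min(curlᵀcurl + d d*) = 2(1 − cos(π∕M))` exactly on the `M³` box, `M ≤ 7`, no zero mode); the box identity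
  behind STEP 1 — `CURL_in + DIV_box = Σ_κ[GRAD_box(g_κ) + Dirichlet ghosts at the two κ-ends]` — checked as matrices for `M ≤ 5`, `d ∈ {2,3}` (kit j326216).  Matrix-valued one-forms: componentwise.
HONEST SCOPE.  Flat lattice calculus ([folklore]; the discrete Gaffney–Friedrichs inequality on a cube); no curved statement; nothing of print asserted; rung R3, not Clay; YM gap NOT proved.

References: T. Bałaban, CMP **95** (1984) 17–40 [Balaban1984PropagatorsI] ((1.21) p.21, Prop. 1.1 p.33); CMP **99** (1985) 389–434 [Balaban1985BackgroundPropagators] ((3.8)–(3.10) p.392,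
Thm 3.11 p.416); M. Giaquinta, *Multiple integrals …* (1983) [Giaquinta1984] (Ch. III §1).
-/

set_option autoImplicit false

noncomputable section

open scoped BigOperators
open Finset

namespace Summit.QuantumFields.YangMills.Theorems.Prop7LatticeBoxFriedrichs

open Literature.MathematicalPhysics.QuantumFieldTheory.Balaban1983to89.B4Eq19LatticeOperators
open Summit.QuantumFields.YangMills.Theorems.Prop7LatticeWeitzenbockZd (sum_grad_sq_eq_half_curl_sq_add_dvg_sq)

variable {d : ℕ}

/-! ## §1 Box lemmas: a plaquette not inside the box carries at most one box edge -/

/-- `(y + e_μ) i = y i + [i = μ]`. [folklore] [cite: Giaquinta1984, Ch. III §1 p.64] -/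
theorem add_unitVec_apply (y : Zd d) (μ i : Fin d) : (y + unitVec μ) i = y i + if i = μ then 1 else 0 := by
  simp [unitVec, Pi.single_apply]

/-- **Two adjacent corners in the box ⟹ the unit square is in the box** (boxes are products of intervals): `y + e_μ, y + e_ν ∈ Q_r(z)`, `μ ≠ ν` ⟹
`y ∈ Q_r(z)` and `y + e_μ + e_ν ∈ Q_r(z)`. [folklore] [cite: Giaquinta1984, Ch. III §1 p.64] -/
theorem mem_box_and_of_add_unitVec_mem {z y : Zd d} {r : ℤ} {μ ν : Fin d} (hμν : μ ≠ ν)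
    (hμ : y + unitVec μ ∈ box z r) (hν : y + unitVec ν ∈ box z r) : y ∈ box z r ∧ y + unitVec μ + unitVec ν ∈ box z r := by
  rw [mem_box] at hμ hν
  refine ⟨mem_box.2 fun i => ?_, mem_box.2 fun i => ?_⟩
  · by_cases hi : i = μ
    · have hiν : i ≠ ν := fun h => hμν (hi.symm.trans h)
      have h := hν i
      rw [add_unitVec_apply, if_neg hiν, add_zero] at h
      exact h
    · have h := hμ i
      rw [add_unitVec_apply, if_neg hi, add_zero] at h
      exact h
  · rw [add_unitVec_apply, add_unitVec_apply]
    by_cases hi : i = μ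
    · have hiν : i ≠ ν := fun h => hμν (hi.symm.trans h)
      have h := hμ i
      rw [add_unitVec_apply, if_pos hi] at h
      rw [if_pos hi, if_neg hiν, add_zero]
      exact h
    · have h := hν i
      rw [add_unitVec_apply] at h
      rw [if_neg hi, add_zero]
      exact h

/-- ★ **A PLAQUETTE NOT INSIDE THE BOX CARRIES AT MOST ONE BOX EDGE**: for a one-form `g` vanishing on every edge `⟨y, y + e_μ⟩` not inside `Q_r(z)` and a plaquette `(y; μ, ν)`,
`μ ≠ ν`, that is NOT inside the box (`¬(y ∈ Q_r ∧ y + e_μ + e_ν ∈ Q_r)`), the product `∂_μ g_ν(y)·∂_ν g_μ(y)` vanishes. [folklore] [cite: Giaquinta1984, Ch. III §1 p.64] -/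
theorem fdiff_mul_fdiff_eq_zero_of_not_inside {g : Zd d → Fin d → ℝ} {z : Zd d} {r : ℤ}
    (hg : ∀ (y : Zd d) (μ : Fin d), (y ∉ box z r ∨ y + unitVec μ ∉ box z r) → g y μ = 0)
    {μ ν : Fin d} (hμν : μ ≠ ν) (y : Zd d) (hni : ¬ (y ∈ box z r ∧ y + unitVec μ + unitVec ν ∈ box z r)) :
    fdiff μ (fun x => g x ν) y * fdiff ν (fun x => g x μ) y = 0 := by
  simp only [fdiff]
  by_cases hy : y ∈ box z r
  · -- then the far corner is outside: the two far edges vanish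
    have hc : y + unitVec μ + unitVec ν ∉ box z r := fun h => hni ⟨hy, h⟩
    have hc' : y + unitVec ν + unitVec μ ∉ box z r := by rwa [add_right_comm] at hc
    have e1 : g (y + unitVec μ) ν = 0 := hg _ _ (Or.inr hc)
    have e2 : g (y + unitVec ν) μ = 0 := hg _ _ (Or.inr hc')
    rw [e1, e2]
    by_cases h1 : y + unitVec μ ∈ box z r
    · by_cases h2 : y + unitVec ν ∈ box z r
      · exact absurd (mem_box_and_of_add_unitVec_mem hμν h1 h2).2 hc
      · rw [hg y ν (Or.inr h2)]; ring
    · rw [hg y μ (Or.inr h1)]; ring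
  · -- `y` outside: the two near edges vanish
    have e1 : g y ν = 0 := hg _ _ (Or.inl hy)
    have e2 : g y μ = 0 := hg _ _ (Or.inl hy)
    rw [e1, e2]
    by_cases h1 : y + unitVec μ ∈ box z r
    · by_cases h2 : y + unitVec ν ∈ box z r
      · exact absurd (mem_box_and_of_add_unitVec_mem hμν h1 h2).1 hy
      · rw [hg (y + unitVec ν) μ (Or.inl h2)]; ring
    · rw [hg (y + unitVec μ) ν (Or.inl h1)]; ring

/-- Hence on such a plaquette `(∂_μ g_ν − ∂_ν g_μ)² = (∂_μ g_ν)² + (∂_ν g_μ)²`. [folklore] [cite: Giaquinta1984, Ch. III §1 p.64] -/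
theorem curl_sq_eq_of_not_inside {g : Zd d → Fin d → ℝ} {z : Zd d} {r : ℤ}
    (hg : ∀ (y : Zd d) (μ : Fin d), (y ∉ box z r ∨ y + unitVec μ ∉ box z r) → g y μ = 0)
    {μ ν : Fin d} (hμν : μ ≠ ν) (y : Zd d) (hni : ¬ (y ∈ box z r ∧ y + unitVec μ + unitVec ν ∈ box z r)) :
    (fdiff μ (fun x => g x ν) y - fdiff ν (fun x => g x μ) y) ^ 2 = fdiff μ (fun x => g x ν) y ^ 2 + fdiff ν (fun x => g x μ) y ^ 2 := by
  have h0 := fdiff_mul_fdiff_eq_zero_of_not_inside hg hμν y hni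
  calc (fdiff μ (fun x => g x ν) y - fdiff ν (fun x => g x μ) y) ^ 2
      = fdiff μ (fun x => g x ν) y ^ 2 + fdiff ν (fun x => g x μ) y ^ 2 - 2 * (fdiff μ (fun x => g x ν) y * fdiff ν (fun x => g x μ) y) := by ring
    _ = fdiff μ (fun x => g x ν) y ^ 2 + fdiff ν (fun x => g x μ) y ^ 2 := by rw [h0]; ring

/-- **TERMWISE CURL BOUND**: every plaquette's squared curl is at most the inside part plus, off the diagonal, the two transverse-gradient squares.
[folklore] [cite: Giaquinta1984, Ch. III §1 p.64] -/
theorem curl_sq_le_inside_add {g : Zd d → Fin d → ℝ} {z : Zd d} {r : ℤ}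
    (hg : ∀ (y : Zd d) (μ : Fin d), (y ∉ box z r ∨ y + unitVec μ ∉ box z r) → g y μ = 0) (y : Zd d) (μ ν : Fin d) :
    (fdiff μ (fun x => g x ν) y - fdiff ν (fun x => g x μ) y) ^ 2
      ≤ (if y ∈ box z r ∧ y + unitVec μ + unitVec ν ∈ box z r then (fdiff μ (fun x => g x ν) y - fdiff ν (fun x => g x μ) y) ^ 2 else 0)
        + (if μ ≠ ν then fdiff μ (fun x => g x ν) y ^ 2 + fdiff ν (fun x => g x μ) y ^ 2 else 0) := by
  by_cases hμν : μ ≠ ν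
  · rw [if_pos hμν]
    by_cases hin : y ∈ box z r ∧ y + unitVec μ + unitVec ν ∈ box z r
    · rw [if_pos hin]; nlinarith [sq_nonneg (fdiff μ (fun x => g x ν) y), sq_nonneg (fdiff ν (fun x => g x μ) y)]
    · rw [if_neg hin, curl_sq_eq_of_not_inside hg hμν y hin]; linarith
  · rw [not_ne_iff] at hμν
    subst hμν
    simp

/-! ## §2 The lattice Friedrichs inequality on a box -/

section Friedrichs

variable {g : Zd d → Fin d → ℝ} {z : Zd d} {R : ℤ}

/-- A one-form living on the edges of `Q_R(z)` is supported in `Q_R(z) = Q_{(R+2)−2}(z)`. [folklore] [cite: Giaquinta1984, Ch. III §1 p.64] -/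
theorem support_of_edges (hg : ∀ (y : Zd d) (μ : Fin d), (y ∉ box z R ∨ y + unitVec μ ∉ box z R) → g y μ = 0) :
    ∀ y ∉ box z (R + 2 - 2), ∀ μ, g y μ = 0 := by
  intro y hy μ
  rw [show R + 2 - 2 = R by ring] at hy
  exact hg y μ (Or.inl hy)

/-- The graph divergence of such a one-form vanishes off the box. [folklore] [cite: Giaquinta1984, Ch. III §1 p.64] -/
theorem dvg_eq_zero_of_not_mem (hg : ∀ (y : Zd d) (μ : Fin d), (y ∉ box z R ∨ y + unitVec μ ∉ box z R) → g y μ = 0)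
    (y : Zd d) (hy : y ∉ box z R) : dvg g y = 0 := by
  rw [dvg_apply]
  refine Finset.sum_eq_zero fun μ _ => ?_
  have h1 : g y μ = 0 := hg y μ (Or.inl hy)
  have h2 : g (y - unitVec μ) μ = 0 := hg _ μ (Or.inr (by rwa [sub_add_cancel]))
  rw [h1, h2, sub_zero]

/-- The longitudinal difference `(∂_μ g_μ)²` vanishes off `Q_{R+2}(z)`. [folklore] [cite: Giaquinta1984, Ch. III §1 p.64] -/
theorem fdiff_sq_eq_zero_of_not_mem (hg : ∀ (y : Zd d) (μ : Fin d), (y ∉ box z R ∨ y + unitVec μ ∉ box z R) → g y μ = 0)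
    (μ : Fin d) (y : Zd d) (hy : y ∉ box z (R + 2)) : fdiff μ (fun x => g x μ) y ^ 2 = 0 := by
  have hy1 : y ∉ box z (R + 1) := fun h => hy (box_mono z (by linarith) h)
  have hy0 : y ∉ box z R := fun h => hy (box_mono z (by linarith) h)
  have h1 : g y μ = 0 := hg y μ (Or.inl hy0)
  have h2 : g (y + unitVec μ) μ = 0 := hg _ μ (Or.inl (add_unitVec_not_mem_box hy1 μ))
  simp [fdiff, h1, h2]

/-- Sums of a nonnegative function over any finset are bounded by its sum over a finset containing its support. [folklore] [cite: Giaquinta1984, Ch. III §1 p.64] -/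
theorem sum_le_sum_of_support {s t : Finset (Zd d)} {F : Zd d → ℝ} (hF0 : ∀ y, 0 ≤ F y) (hFt : ∀ y ∉ t, F y = 0) :
    ∑ y ∈ s, F y ≤ ∑ y ∈ t, F y := by
  classical
  calc ∑ y ∈ s, F y = ∑ y ∈ s ∩ t, F y := by
        refine (Finset.sum_subset Finset.inter_subset_left fun y hys hyn => hFt y fun hyt => hyn ?_).symm
        exact Finset.mem_inter.2 ⟨hys, hyt⟩
    _ ≤ ∑ y ∈ t, F y := Finset.sum_le_sum_of_subset_of_nonneg Finset.inter_subset_right fun y _ _ => hF0 y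

/-- **STEP 1 — THE LONGITUDINAL DIFFERENCES ARE CONTROLLED BY THE INSIDE CURL AND THE GRAPH DIVERGENCE**:
`Σ_{Q_{R+2}} Σ_μ (∂_μ g_μ)² ≤ ½·Σ_{Q_{R+2}} Σ_μ Σ_ν [plaquette inside Q_R]·(∂_μ g_ν − ∂_ν g_μ)² + Σ_{Q_{R+2}} (∂*g)²` (Weitzenböck on `ℤᵈ` minus the transverse squares, which dominate
the straddling plaquettes). [folklore] [cite: Balaban1984PropagatorsI, (1.21) p.21] -/
theorem sum_longitudinal_sq_le (hg : ∀ (y : Zd d) (μ : Fin d), (y ∉ box z R ∨ y + unitVec μ ∉ box z R) → g y μ = 0) :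
    ∑ y ∈ box z (R + 2), ∑ μ, fdiff μ (fun x => g x μ) y ^ 2
      ≤ (1 / 2) * ∑ y ∈ box z (R + 2), ∑ μ, ∑ ν,
            (if y ∈ box z R ∧ y + unitVec μ + unitVec ν ∈ box z R then (fdiff μ (fun x => g x ν) y - fdiff ν (fun x => g x μ) y) ^ 2 else 0)
        + ∑ y ∈ box z (R + 2), dvg g y ^ 2 := by
  have W := sum_grad_sq_eq_half_curl_sq_add_dvg_sq g z (R + 2) (support_of_edges hg)
  -- G = LONG + TRANSV
  have hsplit : ∀ y : Zd d, ∑ μ, ∑ ν, fdiff ν (fun x => g x μ) y ^ 2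
      = ∑ μ, fdiff μ (fun x => g x μ) y ^ 2 + ∑ μ, ∑ ν, (if μ ≠ ν then fdiff ν (fun x => g x μ) y ^ 2 else 0) := by
    intro y
    rw [← Finset.sum_add_distrib]
    refine Finset.sum_congr rfl fun μ _ => ?_
    have hpt : ∀ ν, fdiff ν (fun x => g x μ) y ^ 2
        = (if μ = ν then fdiff ν (fun x => g x μ) y ^ 2 else 0) + (if μ ≠ ν then fdiff ν (fun x => g x μ) y ^ 2 else 0) := by
      intro ν; by_cases h : μ = ν <;> simp [h]
    rw [Finset.sum_congr rfl (fun ν _ => hpt ν), Finset.sum_add_distrib, Finset.sum_ite_eq]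
    simp
  have hG : ∑ y ∈ box z (R + 2), ∑ μ, ∑ ν, fdiff ν (fun x => g x μ) y ^ 2
      = ∑ y ∈ box z (R + 2), ∑ μ, fdiff μ (fun x => g x μ) y ^ 2
        + ∑ y ∈ box z (R + 2), ∑ μ, ∑ ν, (if μ ≠ ν then fdiff ν (fun x => g x μ) y ^ 2 else 0) := by
    rw [← Finset.sum_add_distrib]
    exact Finset.sum_congr rfl fun y _ => hsplit y
  -- C ≤ C_in + (transverse squares)
  have hC : ∑ y ∈ box z (R + 2), ∑ μ, ∑ ν, (fdiff μ (fun x => g x ν) y - fdiff ν (fun x => g x μ) y) ^ 2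
      ≤ ∑ y ∈ box z (R + 2), ∑ μ, ∑ ν,
            (if y ∈ box z R ∧ y + unitVec μ + unitVec ν ∈ box z R then (fdiff μ (fun x => g x ν) y - fdiff ν (fun x => g x μ) y) ^ 2 else 0)
        + ∑ y ∈ box z (R + 2), ∑ μ, ∑ ν, (if μ ≠ ν then fdiff μ (fun x => g x ν) y ^ 2 + fdiff ν (fun x => g x μ) y ^ 2 else 0) := by
    rw [← Finset.sum_add_distrib]
    refine Finset.sum_le_sum fun y _ => ?_
    rw [← Finset.sum_add_distrib]
    refine Finset.sum_le_sum fun μ _ => ?_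
    rw [← Finset.sum_add_distrib]
    exact Finset.sum_le_sum fun ν _ => curl_sq_le_inside_add hg y μ ν
  -- the transverse squares are twice TRANSV
  have hT : ∀ y : Zd d, ∑ μ, ∑ ν, (if μ ≠ ν then fdiff μ (fun x => g x ν) y ^ 2 + fdiff ν (fun x => g x μ) y ^ 2 else 0)
      = 2 * ∑ μ, ∑ ν, (if μ ≠ ν then fdiff ν (fun x => g x μ) y ^ 2 else 0) := by
    intro y
    have h1 : ∑ μ, ∑ ν, (if μ ≠ ν then fdiff μ (fun x => g x ν) y ^ 2 else (0 : ℝ))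
        = ∑ μ, ∑ ν, (if μ ≠ ν then fdiff ν (fun x => g x μ) y ^ 2 else 0) := by
      rw [Finset.sum_comm]
      refine Finset.sum_congr rfl fun μ _ => Finset.sum_congr rfl fun ν _ => ?_
      simp only [ne_comm]
    have h2 : ∀ μ ν : Fin d, (if μ ≠ ν then fdiff μ (fun x => g x ν) y ^ 2 + fdiff ν (fun x => g x μ) y ^ 2 else (0 : ℝ))
        = (if μ ≠ ν then fdiff μ (fun x => g x ν) y ^ 2 else 0) + (if μ ≠ ν then fdiff ν (fun x => g x μ) y ^ 2 else 0) := by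
      intro μ ν; split_ifs <;> simp
    simp only [h2, Finset.sum_add_distrib]
    rw [h1]
    ring
  have hT' : ∑ y ∈ box z (R + 2), ∑ μ, ∑ ν, (if μ ≠ ν then fdiff μ (fun x => g x ν) y ^ 2 + fdiff ν (fun x => g x μ) y ^ 2 else 0)
      = 2 * ∑ y ∈ box z (R + 2), ∑ μ, ∑ ν, (if μ ≠ ν then fdiff ν (fun x => g x μ) y ^ 2 else 0) := by
    rw [Finset.mul_sum]
    exact Finset.sum_congr rfl fun y _ => hT y
  rw [hT'] at hC
  linarith [hG, W, hC]

/-- **STEP 2 — ONE EDGE VALUE BY TELESCOPING ALONG ITS LINE**: for `y ∈ Q_R(z)`, `(g y μ)² ≤ (2R+1)·Σ_{t<2R+1} (∂_μ g_μ)(y + t·e_μ)²` (the line leaves the box after `2R + 1` steps,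
where `g` vanishes; Cauchy–Schwarz). [folklore] [cite: Giaquinta1984, Ch. III §1 p.64] -/
theorem sq_le_line_sum (hR : 0 ≤ R) (hg : ∀ (y : Zd d) (μ : Fin d), (y ∉ box z R ∨ y + unitVec μ ∉ box z R) → g y μ = 0)
    {y : Zd d} (hy : y ∈ box z R) (μ : Fin d) :
    g y μ ^ 2 ≤ (2 * (R : ℝ) + 1) * ∑ t ∈ Finset.range (2 * R + 1).toNat, fdiff μ (fun x => g x μ) (y + t • unitVec μ) ^ 2 := by
  set T : ℕ := (2 * R + 1).toNat with hT
  have hTZ : (T : ℤ) = 2 * R + 1 := Int.toNat_of_nonneg (by linarith)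
  have hTR : (T : ℝ) = 2 * (R : ℝ) + 1 := by exact_mod_cast hTZ
  -- telescoping
  have htel : ∑ t ∈ Finset.range T, fdiff μ (fun x => g x μ) (y + t • unitVec μ) = g (y + T • unitVec μ) μ - g y μ := by
    have h := Finset.sum_range_sub (fun t : ℕ => g (y + t • unitVec μ) μ) T
    simp only [zero_smul, add_zero] at h
    rw [← h]
    refine Finset.sum_congr rfl fun t _ => ?_
    simp only [fdiff, succ_nsmul, add_assoc]
  -- the far end is outside the box
  have hout : y + T • unitVec μ ∉ box z R := by
    intro h
    have hc : (y + T • unitVec μ) μ = y μ + (T : ℤ) := by simp [unitVec]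
    have h1 := (mem_box.1 h) μ
    have h0 := (mem_box.1 hy) μ
    rw [hc, hTZ] at h1
    rw [abs_le] at h0 h1
    linarith [h0.1, h1.2]
  have hfar : g (y + T • unitVec μ) μ = 0 := hg _ μ (Or.inl hout)
  have hg_eq : g y μ = -∑ t ∈ Finset.range T, fdiff μ (fun x => g x μ) (y + t • unitVec μ) := by
    rw [htel, hfar]; ring
  calc g y μ ^ 2 = (∑ t ∈ Finset.range T, fdiff μ (fun x => g x μ) (y + t • unitVec μ)) ^ 2 := by rw [hg_eq, neg_sq]
    _ ≤ (Finset.range T).card * ∑ t ∈ Finset.range T, fdiff μ (fun x => g x μ) (y + t • unitVec μ) ^ 2 := sq_sum_le_card_mul_sum_sq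
    _ = (2 * (R : ℝ) + 1) * ∑ t ∈ Finset.range T, fdiff μ (fun x => g x μ) (y + t • unitVec μ) ^ 2 := by
        rw [Finset.card_range, hTR]

/-- **STEP 2, SUMMED**: `Σ_{Q_R} (g·μ)² ≤ (2R+1)²·Σ_{Q_{R+2}} (∂_μ g_μ)²`. [folklore] [cite: Giaquinta1984, Ch. III §1 p.64] -/
theorem sum_sq_le_longitudinal (hR : 0 ≤ R) (hg : ∀ (y : Zd d) (μ : Fin d), (y ∉ box z R ∨ y + unitVec μ ∉ box z R) → g y μ = 0)
    (μ : Fin d) :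
    ∑ y ∈ box z R, g y μ ^ 2 ≤ (2 * (R : ℝ) + 1) ^ 2 * ∑ y ∈ box z (R + 2), fdiff μ (fun x => g x μ) y ^ 2 := by
  set T : ℕ := (2 * R + 1).toNat with hT
  have hTZ : (T : ℤ) = 2 * R + 1 := Int.toNat_of_nonneg (by linarith)
  have hTR : (T : ℝ) = 2 * (R : ℝ) + 1 := by exact_mod_cast hTZ
  have hF0 : ∀ w : Zd d, 0 ≤ fdiff μ (fun x => g x μ) w ^ 2 := fun w => sq_nonneg _
  -- each shifted line sum is bounded by the sum over `Q_{R+2}`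
  have hshift : ∀ t : ℕ, ∑ y ∈ box z R, fdiff μ (fun x => g x μ) (y + t • unitVec μ) ^ 2 ≤ ∑ y ∈ box z (R + 2), fdiff μ (fun x => g x μ) y ^ 2 := by
    intro t
    rw [sum_box_add_right (fun w => fdiff μ (fun x => g x μ) w ^ 2) z (t • unitVec μ) R]
    exact sum_le_sum_of_support hF0 (fdiff_sq_eq_zero_of_not_mem hg μ)
  calc ∑ y ∈ box z R, g y μ ^ 2
      ≤ ∑ y ∈ box z R, (2 * (R : ℝ) + 1) * ∑ t ∈ Finset.range T, fdiff μ (fun x => g x μ) (y + t • unitVec μ) ^ 2 :=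
        Finset.sum_le_sum fun y hy => sq_le_line_sum hR hg hy μ
    _ = (2 * (R : ℝ) + 1) * ∑ t ∈ Finset.range T, ∑ y ∈ box z R, fdiff μ (fun x => g x μ) (y + t • unitVec μ) ^ 2 := by
        rw [← Finset.mul_sum, Finset.sum_comm]
    _ ≤ (2 * (R : ℝ) + 1) * ∑ t ∈ Finset.range T, ∑ y ∈ box z (R + 2), fdiff μ (fun x => g x μ) y ^ 2 := by
        have hR' : (0 : ℝ) ≤ (R : ℝ) := by exact_mod_cast hR
        have h2R : (0 : ℝ) ≤ 2 * (R : ℝ) + 1 := by linarith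
        exact mul_le_mul_of_nonneg_left (Finset.sum_le_sum fun t _ => hshift t) h2R
    _ = (2 * (R : ℝ) + 1) ^ 2 * ∑ y ∈ box z (R + 2), fdiff μ (fun x => g x μ) y ^ 2 := by
        rw [Finset.sum_const, Finset.card_range, nsmul_eq_mul, hTR]; ring

/-- ★★★ **THE LATTICE FRIEDRICHS INEQUALITY ON A BOX** (discrete Gaffney–Friedrichs on the cube `Q_R(z) ⊂ ℤᵈ`, `M = 2R+1` sites per side, zero-flux boundary condition built into
the graph divergence, curl over INSIDE plaquettes only, no mean ∕ harmonic term): for a one-form `g` vanishing on every edge `⟨y, y+e_μ⟩` not inside `Q_R(z)`,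
`Σ_{y∈Q_R} Σ_μ (g y μ)² ≤ (2R+1)²·(½·Σ_{y∈Q_R} Σ_μ Σ_ν [y + e_μ + e_ν ∈ Q_R]·(∂_μ g_ν − ∂_ν g_μ)(y)² + Σ_{y∈Q_R} (∂*g)(y)²)`.
(Sharp constant `1∕(2(1 − cos(π∕M))) ≤ M²∕8`, kit j326138; LOCATE #60 brick (B1).) [folklore] [cite: Balaban1984PropagatorsI, (1.21) p.21, Prop. 1.1 p.33; Giaquinta1984, Ch. III §1 p.64] -/
theorem sum_sq_le_box_friedrichs (hR : 0 ≤ R)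
    (hg : ∀ (y : Zd d) (μ : Fin d), (y ∉ box z R ∨ y + unitVec μ ∉ box z R) → g y μ = 0) :
    ∑ y ∈ box z R, ∑ μ, g y μ ^ 2
      ≤ (2 * (R : ℝ) + 1) ^ 2 *
        ((1 / 2) * ∑ y ∈ box z R, ∑ μ, ∑ ν,
            (if y + unitVec μ + unitVec ν ∈ box z R then (fdiff μ (fun x => g x ν) y - fdiff ν (fun x => g x μ) y) ^ 2 else 0)
          + ∑ y ∈ box z R, dvg g y ^ 2) := by
  have hsub : box z R ⊆ box z (R + 2) := box_mono z (by linarith)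
  -- Step 2 summed over `μ`
  have h2 : ∑ y ∈ box z R, ∑ μ, g y μ ^ 2 ≤ (2 * (R : ℝ) + 1) ^ 2 * ∑ y ∈ box z (R + 2), ∑ μ, fdiff μ (fun x => g x μ) y ^ 2 :=
    calc ∑ y ∈ box z R, ∑ μ, g y μ ^ 2 = ∑ μ, ∑ y ∈ box z R, g y μ ^ 2 := Finset.sum_comm
      _ ≤ ∑ μ, (2 * (R : ℝ) + 1) ^ 2 * ∑ y ∈ box z (R + 2), fdiff μ (fun x => g x μ) y ^ 2 :=
          Finset.sum_le_sum fun μ _ => sum_sq_le_longitudinal hR hg μ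
      _ = (2 * (R : ℝ) + 1) ^ 2 * ∑ y ∈ box z (R + 2), ∑ μ, fdiff μ (fun x => g x μ) y ^ 2 := by
          rw [← Finset.mul_sum, Finset.sum_comm]
  -- Step 1, with the sums over `Q_{R+2}` restricted to `Q_R`
  have h1 := sum_longitudinal_sq_le hg
  have hCin : ∑ y ∈ box z (R + 2), ∑ μ, ∑ ν,
        (if y ∈ box z R ∧ y + unitVec μ + unitVec ν ∈ box z R then (fdiff μ (fun x => g x ν) y - fdiff ν (fun x => g x μ) y) ^ 2 else (0 : ℝ))
      = ∑ y ∈ box z R, ∑ μ, ∑ ν,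
        (if y + unitVec μ + unitVec ν ∈ box z R then (fdiff μ (fun x => g x ν) y - fdiff ν (fun x => g x μ) y) ^ 2 else 0) := by
    rw [← Finset.sum_subset hsub (fun y _ hy => by simp [hy])]
    exact Finset.sum_congr rfl fun y hy => by simp [hy]
  have hDv : ∑ y ∈ box z (R + 2), dvg g y ^ 2 = ∑ y ∈ box z R, dvg g y ^ 2 := by
    rw [← Finset.sum_subset hsub (fun y _ hy => by rw [dvg_eq_zero_of_not_mem hg y hy]; ring)]
  rw [hCin, hDv] at h1
  have h2R : (0 : ℝ) ≤ (2 * (R : ℝ) + 1) ^ 2 := sq_nonneg _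
  exact h2.trans (mul_le_mul_of_nonneg_left h1 h2R)

/-- **KILL TEST (F1) OF LOCATE #60, KERNEL-VISIBLE**: the inequality at the `M = 2` cube of `ℤ³` (`R = … `, here stated for the box `Q_R(0)` with `2R + 1 = M`; the finite check
`λ_min = 2(1 − cos(π∕M))`, no zero mode, is kit j326138). [folklore] [cite: Balaban1984PropagatorsI, (1.21) p.21] -/
example (g : Zd 3 → Fin 3 → ℝ) (R : ℤ) (hR : 0 ≤ R)
    (hg : ∀ (y : Zd 3) (μ : Fin 3), (y ∉ box 0 R ∨ y + unitVec μ ∉ box 0 R) → g y μ = 0) :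
    ∑ y ∈ box 0 R, ∑ μ, g y μ ^ 2
      ≤ (2 * (R : ℝ) + 1) ^ 2 *
        ((1 / 2) * ∑ y ∈ box 0 R, ∑ μ, ∑ ν,
            (if y + unitVec μ + unitVec ν ∈ box 0 R then (fdiff μ (fun x => g x ν) y - fdiff ν (fun x => g x μ) y) ^ 2 else 0)
          + ∑ y ∈ box 0 R, dvg g y ^ 2) :=
  sum_sq_le_box_friedrichs hR hg

end Friedrichs

end Summit.QuantumFields.YangMills.Theorems.Prop7LatticeBoxFriedrichs

end
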